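import Summits.BirchSwinnertonDyer.Rank1Residual.X11b.TwistTransportTam
import Summits.BirchSwinnertonDyer.Rank1Residual.X11b.CastellaErratumTwist
import Literature.NumberTheory.EllipticCurves.PastenValuationProductThm115Proofs
import Literature.NumberTheory.EllipticCurves.TamagawaVariableChangeProofs
import Literature.NumberTheory.EllipticCurves.TamagawaNeZeroProofs
import Literature.NumberTheory.EllipticCurves.TamagawaProofs
import HarnessLib

/-!
# Route `ErratumRoadFive`, crux `EulerHalfNotRamNoInertSetAtFive` (item stmt-BirchSwinnertonDyer-19715), crux idea
# `ramified-twin-ram-transport` (bsd-idea-9 g14): the TAMAGAWA TRANSPORT of the genus frame — `ord_p ∏_ℓ c_ℓ(E^{(d_K)}) =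
# ord_p ∏_ℓ c_ℓ(E)` when `K` is split at every bad prime EXCEPT ONE, at which neither curve is split multiplicative

Cell `bsd-stepL` (run/shared/lean/pub/bsd-stepL/), seat `bsd-line-er5-p1-w8` (D-0154 width seat -w8 gen 8 on crux
19715), `--supports stmt-BirchSwinnertonDyer-19715`. THEOREMS ONLY (no definition, no named fact, no `sorry`);
elementary local arithmetic.

## What

The S1b core of line `birth` v17 (`JetchevMaxHLAtP.missingUpperBoundAt_of_classX11b_…_of_lowerX11a`, §3 of
`Theorems/ErratumRoadFiveEulerHalfJetchevMaxHLAtPConsumer.lean`) feeds its descent step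
`missingUpperBoundAt_of_shaIndexBound_sharp` with `htam : ord_p ∏c(Wd) = ord_p ∏c(W)` for the twin
`Wd = Cd • E^{(d_K)}`, obtained from `X2.padicValNat_tamagawaProduct_twist_of_heegner_of_odd` — which needs the
CLASSICAL Heegner hypothesis `SatisfiesHeegnerHypothesis N_E K` (every bad prime split). In the idea card's GENUS
FRAME the Kolyvagin field `K` is RAMIFIED at one odd additive potentially multiplicative prime `q` of `E` and split
at every other bad prime; `E` is additive at `q` and the twin is NONSPLIT multiplicative at `q` (the supply
`GenusFrameTwistSupply`'s clause, forced by the sign condition = Cai–Shu–Tian's Heegner condition (2)). The Tamagawa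
transport SURVIVES: at the split bad primes `d_K ∈ ℚ_ℓ^{×2}` and the curves are `ℚ_ℓ`-isomorphic; at `q` both local
Tamagawa numbers are `≤ 4 < p` (Kodaira–Néron: `c ≤ 4` unless the reduction is split multiplicative — `E` is
additive, the twin nonsplit); at `ℓ ∤ N` the twin is good or additive (`j(Wd) = j(W)` is `ℓ`-integral).

## Theorems (namespace `…Theorems.RamifiedTwinRamTransport`)

* `padicValNat_localTamagawaNumber_eq_zero_of_not_split` — `c(X/ℚ_ℓ)` is a `p`-unit for `p ≥ 5` unless the
  minimal model is split multiplicative (Kodaira–Néron `c ≤ 4`).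
* `padicValNat_localTamagawaNumber_twist_eq_offPrime` — prime by prime: `ord_p c_ℓ(Wd) = ord_p c_ℓ(W)` for every
  `ℓ`, `p ≥ 5`, `[K:ℚ] = 2`, every `ℓ ∣ N_W` with `ℓ ≠ q` split in `K`, `W` and `Wd` not split multiplicative at `q`.
* `padicValNat_tamagawaProduct_twist_eq_offPrime` — the product: `ord_p ∏c(Wd) = ord_p ∏c(W)`.
* `padicValNat_tamagawaProduct_ramTwin_eq` — the same in the card's binders (`Addv W q`, the twin nonsplit
  multiplicative at `q`, `K` imaginary quadratic).

The companion transports of the frame at the SPLIT prime `p` are already per-prime theorems of the tree and are not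
repeated: `X11b.padicValRat_u_eq_zero_of_twist_minimal_of_splitsIn` (`ord_p u(Cd) = 0`), `X11b.mult_iff_of_twist`
(multiplicative reduction), `X11b.padicValInt_minimalDiscriminantInt_eq_of_twist` (`ord_p Δ_min`).

HONEST FRAMING: elementary glue; NOT a registered stub of line `birth` (v17 has none open); closes nothing — crux
19715 stays closed modulo its route items; BSD is proved for no curve.
-/

set_option autoImplicit false

noncomputable section

open scoped Classical

open WeierstrassCurve NumberField Literature.NumberTheory.EllipticCurves Rat.HeightOneSpectrum
  Literature.NumberTheory.EllipticCurves.Rank1Residual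
  Summit.BirchSwinnertonDyer.Rank1Residual

-- the cell's Theorems namespace repeats the summit name (Summit.<Summit>.<Problem>), as in every sibling file
set_option linter.dupNamespace false

namespace Summit.BirchSwinnertonDyer.BirchSwinnertonDyer.Theorems.RamifiedTwinRamTransport

/-! ### A local Tamagawa number is a `p`-unit for `p ≥ 5` off split multiplicative reduction -/

/-- **`ord_p c(X/ℚ_ℓ) = 0` for `p ≥ 5` unless the minimal model of `X/ℚ_ℓ` is split multiplicative**
(Kodaira–Néron: `c ≤ 4` in every other case, `localTamagawaNumber_padic_le_four`; `c ≠ 0`,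
`localTamagawaNumber_padic_ne_zero_holds`). [cite: SilvermanATAEC1994, Cor. IV.9.2(d) (PDF p. 340)] -/
theorem padicValNat_localTamagawaNumber_eq_zero_of_not_split (p : ℕ) [Fact p.Prime] (hp5 : 5 ≤ p)
    (ℓ : ℕ) [Fact ℓ.Prime] (X : WeierstrassCurve ℚ_[ℓ]) [X.IsElliptic]
    (hns : ¬ (X.minimal ℤ_[ℓ]).HasSplitMultiplicativeReduction ℤ_[ℓ]) :
    padicValNat p (X.localTamagawaNumber ℤ_[ℓ]) = 0 := by
  have h4 := localTamagawaNumber_padic_le_four ℓ X hns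
  have hne := localTamagawaNumber_padic_ne_zero_holds ℓ X
  rw [padicValNat.eq_zero_of_not_dvd]
  intro hdvd
  have := Nat.le_of_dvd (Nat.pos_of_ne_zero hne) hdvd
  omega

/-! ### Prime by prime -/

/-- Equal Weierstrass equations have equal `j` (whatever the `IsElliptic` witnesses). [folklore] -/
private theorem j_eq_of_eq' {A : Type*} [CommRing A] {X Y : WeierstrassCurve A} [X.IsElliptic]
    [Y.IsElliptic] (h : X = Y) : X.j = Y.j := by
  subst h
  rfl

/-- **`ord_p c_ℓ(E^{(d_K)}) = ord_p c_ℓ(E)` at every prime `ℓ`, for `p ≥ 5`, when `K` is split at every bad prime of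
`E` except `q` and neither curve is split multiplicative at `q`.** `W/ℚ` elliptic of conductor `N`, `[K:ℚ] = 2`,
every prime `ℓ ∣ N` with `ℓ ≠ q` split in `K` (two primes above `ℓ`), `Wd = Cd • W^{(d_K)}` any model of the twist,
`W` and `Wd` NOT split multiplicative at `q`. Cases: `ℓ = q` — both `c ≤ 4 < p`
(`padicValNat_localTamagawaNumber_eq_zero_of_not_split`); `ℓ ∣ N`, `ℓ ≠ q` — `d_K ∈ ℚ_ℓ^{×2}`
(`X11b.isSquare_padic_discr_of_splitsIn`), `Wd ⊗ ℚ_ℓ ≅ W ⊗ ℚ_ℓ` (`X11b.exists_baseChange_eq_smul_of_twist`),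
`c_ℓ(Wd) = c_ℓ(W)` (`localTamagawaNumber_variableChange_holds`); `ℓ ∤ N` — `W` good (`c = 1`), `j(Wd) = j(W)` so `Wd`
is not multiplicative at `ℓ` (`X11b.not_hasMultiplicativeReductionAtPrime_of_j_eq`), `c_ℓ(Wd) ≤ 4 < p`. The
classical all-split case is `X11b.padicValNat_localTamagawaNumber_twist_eq`.
[cite: SilvermanATAEC1994, Cor. IV.9.2(d) (PDF p. 340)] [cite: SilvermanAEC2009, VII.6 Ex. 7.6 and X.5 Cor. 5.4] -/
theorem padicValNat_localTamagawaNumber_twist_eq_offPrime (W : WeierstrassCurve ℚ) [W.IsElliptic]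
    (p : ℕ) [Fact p.Prime] (hp5 : 5 ≤ p) (K : Type) [Field K] [NumberField K]
    (h2 : Module.finrank ℚ K = 2) (q : ℕ) [Fact q.Prime]
    (hsplit : ∀ ℓ : ℕ, ℓ.Prime → ℓ ∣ W.conductorNorm ℤ → ℓ ≠ q →
      ((Ideal.span {(ℓ : ℤ)}).primesOver (𝓞 K)).ncard = 2)
    (hWq : ¬ W.HasSplitMultiplicativeReductionAtPrime q)
    {Wd : WeierstrassCurve ℚ} [Wd.IsElliptic] (Cd : VariableChange ℚ)
    (hWd : Cd • W.quadraticTwist (NumberField.discr K : ℚ) = Wd)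
    (hWdq : ¬ Wd.HasSplitMultiplicativeReductionAtPrime q) (ℓ : ℕ) [Fact ℓ.Prime] :
    padicValNat p ((Wd.baseChange ℚ_[ℓ]).localTamagawaNumber ℤ_[ℓ]) =
      padicValNat p ((W.baseChange ℚ_[ℓ]).localTamagawaNumber ℤ_[ℓ]) := by
  have hℓ : ℓ.Prime := Fact.out
  set d : ℚ := (NumberField.discr K : ℚ) with hd_def
  have hD0 : d ≠ 0 := by rw [hd_def]; exact_mod_cast NumberField.discr_ne_zero K
  haveI : (W.baseChange ℚ_[ℓ]).IsElliptic :=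
    inferInstanceAs (W.map (algebraMap ℚ ℚ_[ℓ])).IsElliptic
  haveI : (Wd.baseChange ℚ_[ℓ]).IsElliptic :=
    inferInstanceAs (Wd.map (algebraMap ℚ ℚ_[ℓ])).IsElliptic
  haveI : (W.quadraticTwist d).IsElliptic := W.isElliptic_quadraticTwist hD0
  by_cases hℓq : ℓ = q
  · -- `ℓ = q`: neither minimal model is split multiplicative, both `c ≤ 4 < p`
    subst hℓq
    rw [padicValNat_localTamagawaNumber_eq_zero_of_not_split p hp5 ℓ _ hWdq,
      padicValNat_localTamagawaNumber_eq_zero_of_not_split p hp5 ℓ _ hWq]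
  by_cases hℓN : ℓ ∣ W.conductorNorm ℤ
  · -- `ℓ ∣ N`, `ℓ ≠ q`: `ℓ` splits in `K`, `d_K` is a square in `ℚ_ℓ`, the two curves are `ℚ_ℓ`-isomorphic
    have hsq : IsSquare ((d : ℚ) : ℚ_[ℓ]) :=
      X11b.isSquare_padic_discr_of_splitsIn h2 (hsplit ℓ hℓ hℓN hℓq)
    obtain ⟨D, hD⟩ := X11b.exists_baseChange_eq_smul_of_twist W hD0 hsq Wd hWd
    rw [hD, localTamagawaNumber_variableChange_holds ℤ_[ℓ] (W.baseChange ℚ_[ℓ]) D]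
  · -- `ℓ ∤ N`: `W` is good at `ℓ`, `Wd` is good or additive at `ℓ`
    have hgood : W.HasGoodReductionAtPrime ℓ := by
      by_contra h
      exact hℓN ((W.dvd_conductorNorm_iff_not_hasGoodReductionAtPrime ℓ).mpr h)
    have hcW : (W.baseChange ℚ_[ℓ]).localTamagawaNumber ℤ_[ℓ] = 1 := by
      haveI : ((W.baseChange ℚ_[ℓ]).minimal ℤ_[ℓ]).HasGoodReduction ℤ_[ℓ] := hgood
      exact localTamagawaNumber_eq_one_of_hasGoodReduction_holds ℤ_[ℓ] _
    have hj : Wd.j = W.j := by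
      rw [j_eq_of_eq' hWd.symm, variableChange_j]
      exact W.j_quadraticTwist hD0
    have hns : ¬ ((Wd.baseChange ℚ_[ℓ]).minimal ℤ_[ℓ]).HasSplitMultiplicativeReduction ℤ_[ℓ] :=
      fun hs ↦ X11b.not_hasMultiplicativeReductionAtPrime_of_j_eq hj ℓ hgood
        hs.toHasMultiplicativeReduction
    rw [hcW, padicValNat_one_right, padicValNat_localTamagawaNumber_eq_zero_of_not_split p hp5 ℓ _ hns]

/-! ### The Tamagawa product -/

/-- `ord_p` of a finite product of non-zero naturals is the sum of the `ord_p`. [folklore] -/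
private theorem padicValNat_finset_prod (p : ℕ) [Fact p.Prime] {ι : Type*} (s : Finset ι)
    (f : ι → ℕ) (hf : ∀ i ∈ s, f i ≠ 0) :
    padicValNat p (∏ i ∈ s, f i) = ∑ i ∈ s, padicValNat p (f i) := by
  induction s using Finset.induction_on with
  | empty => simp
  | insert a s ha ih =>
    rw [Finset.prod_insert ha, Finset.sum_insert ha,
      padicValNat.mul (hf a (Finset.mem_insert_self a s))
        (Finset.prod_ne_zero_iff.mpr fun i hi => hf i (Finset.mem_insert_of_mem hi)),
      ih fun i hi => hf i (Finset.mem_insert_of_mem hi)]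

/-- **Tamagawa transport off one prime: `ord_p ∏_ℓ c_ℓ(E^{(d_K)}) = ord_p ∏_ℓ c_ℓ(E)`** for `p ≥ 5`, `[K:ℚ] = 2`,
every prime `ℓ ∣ N_W` other than `q` split in `K`, `W` and the twist model `Wd = Cd • W^{(d_K)}` not split
multiplicative at `q`. Both products are finite products of local Tamagawa numbers over the union of the bad places
(`tamagawaProduct_eq_prod`), compared prime by prime (`padicValNat_localTamagawaNumber_twist_eq_offPrime`). The
all-split case is `X11b.padicValNat_tamagawaProduct_twist_of_heegner`.
[cite: JetchevSkinnerWan2017, §7.4.1 (eq:tamK) (pp. 29–31)] [cite: SilvermanATAEC1994, Cor. IV.9.2(d) (PDF p. 340)] -/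
theorem padicValNat_tamagawaProduct_twist_eq_offPrime (W : WeierstrassCurve ℚ) [W.IsElliptic]
    (p : ℕ) [Fact p.Prime] (hp5 : 5 ≤ p) (K : Type) [Field K] [NumberField K]
    (h2 : Module.finrank ℚ K = 2) (q : ℕ) [Fact q.Prime]
    (hsplit : ∀ ℓ : ℕ, ℓ.Prime → ℓ ∣ W.conductorNorm ℤ → ℓ ≠ q →
      ((Ideal.span {(ℓ : ℤ)}).primesOver (𝓞 K)).ncard = 2)
    (hWq : ¬ W.HasSplitMultiplicativeReductionAtPrime q)
    {Wd : WeierstrassCurve ℚ} [Wd.IsElliptic] (Cd : VariableChange ℚ)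
    (hWd : Cd • W.quadraticTwist (NumberField.discr K : ℚ) = Wd)
    (hWdq : ¬ Wd.HasSplitMultiplicativeReductionAtPrime q) :
    padicValNat p Wd.tamagawaProduct = padicValNat p W.tamagawaProduct := by
  have hfW : (W.badPlaces ℤ).Finite := W.finite_badPlaces_holds ℤ
  have hfWd : (Wd.badPlaces ℤ).Finite := Wd.finite_badPlaces_holds ℤ
  set s : Finset (IsDedekindDomain.HeightOneSpectrum ℤ) := hfW.toFinset ∪ hfWd.toFinset with hs
  have hsW : ∀ v, ¬ W.HasGoodReductionAt v → v ∈ s := fun v hv ↦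
    Finset.mem_union_left _ (by rw [Set.Finite.mem_toFinset, mem_badPlaces_iff]; exact hv)
  have hsWd : ∀ v, ¬ Wd.HasGoodReductionAt v → v ∈ s := fun v hv ↦
    Finset.mem_union_right _ (by rw [Set.Finite.mem_toFinset, mem_badPlaces_iff]; exact hv)
  rw [tamagawaProduct_eq_prod W s hsW, tamagawaProduct_eq_prod Wd s hsWd,
    padicValNat_finset_prod p s _ fun v _ ↦ ?_, padicValNat_finset_prod p s _ fun v _ ↦ ?_]
  · refine Finset.sum_congr rfl fun v _ ↦ ?_
    haveI := Fact.mk (primesEquiv v).2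
    exact padicValNat_localTamagawaNumber_twist_eq_offPrime W p hp5 K h2 q hsplit hWq Cd hWd hWdq
      (primesEquiv v)
  · haveI := Fact.mk (primesEquiv v).2
    haveI : (Wd.baseChange ℚ_[primesEquiv v]).IsElliptic :=
      inferInstanceAs (Wd.map (algebraMap ℚ ℚ_[primesEquiv v])).IsElliptic
    exact localTamagawaNumber_padic_ne_zero_holds (primesEquiv v) _
  · haveI := Fact.mk (primesEquiv v).2
    haveI : (W.baseChange ℚ_[primesEquiv v]).IsElliptic :=
      inferInstanceAs (W.map (algebraMap ℚ ℚ_[primesEquiv v])).IsElliptic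
    exact localTamagawaNumber_padic_ne_zero_holds (primesEquiv v) _

/-- **The genus frame's Tamagawa transport, in the idea card's binders.** `W/ℚ` elliptic, `p ≥ 5`, `q` a prime of
ADDITIVE reduction of `W` (`Addv W q`; on the served class an odd potentially multiplicative one), `K` imaginary
quadratic in which every bad prime `ℓ ≠ q` of `W` splits (the supply `GenusFrameTwistSupply`'s splitting clause;
`q` itself ramifies), `Wd = Cd • W^{(d_K)}` a model of the twin that is NOT split multiplicative at `q` (the
supply's clause `¬ Wd.HasSplitMultiplicativeReductionAtPrime q`, i.e. the twin is nonsplit multiplicative at `q`):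
`ord_p ∏c(Wd) = ord_p ∏c(W)` — the `htam` input of the S1b descent `missingUpperBoundAt_of_shaIndexBound_sharp` in
the genus frame. [cite: JetchevSkinnerWan2017, §7.4.1 (eq:tamK)] [cite: SilvermanATAEC1994, Cor. IV.9.2(d)] -/
theorem padicValNat_tamagawaProduct_ramTwin_eq (W : WeierstrassCurve ℚ) [W.IsElliptic]
    (p : ℕ) [Fact p.Prime] (hp5 : 5 ≤ p) (K : Type) [Field K] [NumberField K]
    (hK : IsImaginaryQuadratic K) (q : ℕ) [Fact q.Prime] (hadd : Addv W q)
    (hsplit : ∀ ℓ : ℕ, ℓ.Prime → ℓ ∣ W.conductorNorm ℤ → ℓ ≠ q →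
      ((Ideal.span {(ℓ : ℤ)}).primesOver (𝓞 K)).ncard = 2)
    {Wd : WeierstrassCurve ℚ} [Wd.IsElliptic] (Cd : VariableChange ℚ)
    (hWd : Cd • W.quadraticTwist (NumberField.discr K : ℚ) = Wd)
    (hWdq : ¬ Wd.HasSplitMultiplicativeReductionAtPrime q) :
    padicValNat p Wd.tamagawaProduct = padicValNat p W.tamagawaProduct :=
  padicValNat_tamagawaProduct_twist_eq_offPrime W p hp5 K hK.1 q hsplit
    (fun hs ↦ hadd.2 hs.hasMultiplicativeReductionAtPrime) Cd hWd hWdq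

end Summit.BirchSwinnertonDyer.BirchSwinnertonDyer.Theorems.RamifiedTwinRamTransport

end
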